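import Mathlib
import Summits.PneNP.PneNP.Theorems.ClusUniversalCertificateCubeB
import Summits.PneNP.PneNP.Theorems.ClusUniversalCertificateCoordDefs

/-!
# Route ClusUniversalCertificate, crux `UniversalCertAll` — path `coord`: registered stub `stub_baseOnes` (the HYPERCUBE BASE)

Stub file for `stmt-PneNP-19683` (cell pnp-ideate, route `ClusUniversalCertificate`, rung F-N1; path `coord` of pnp-ideate-p1,
skeleton v10 sha16 17bd1559; objects of record `ClusUniversalCertificateCoordDefs.lean` p516754, namespace `…Theorems.ClusCoord`):
**`stub_baseOnes`** — when every block has at most one coordinate, the mixed certificate `UCMix M n blk Y` IS the hypercube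
certificate (`m = 1`), which is PROVED in the tree (`ClusCube.l1Cert_holds`, the polynomial-method theorem R★★ of
`ClusUniversalCertificateCubeB.lean`).  Bookkeeping of the transport:

* `ClusCoord.acodim M Y y` and `ClusCube.codimIn Y y` are the same `sInf` (definitionally);
* from `L1Cert M`: `Σ_i |2 Z_i − |Y|| ≤ Σ_y codim`, hence `Σ_y (M − codim_Y y) ≤ 2 Σ_{i : Fin M} Z_i(Y)` with
  `Z_i(Y) = #{y ∈ Y : y_i = 0}` (`dimSum_le_two_mul_sum_zero`);
* per block `j`: `2^{bsize j} Z_j(Y) + (bsize j − 1)|Y| = Σ_{i ∈ block j} 2 Z_i(Y)` — an EMPTY block contributes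
  `1·|Y| − |Y| = 0`, a SINGLETON block `{i}` contributes `2 Z_i(Y)`; summing over the blocks (`Finset.sum_fiberwise`) gives
  `2 Σ_i Z_i(Y)`, which is the mixed certificate.

FRONTIER rung F-N1 (a combinatorial certificate about affine flats in `𝔽₂^M`); the path's conjecture (`stub_peelZeroRareBig`) and the
crux are OPEN; nothing here bears on P vs NP.
-/

set_option linter.dupNamespace false -- `Summit.PneNP.PneNP.…`: summit = sub-problem name (D-0017 single-conjunct layout)

namespace Summit.PneNP.PneNP.Theorems.ClusCoordBaseOnes

open Finset
open Summit.PneNP.PneNP.Theorems.ClusCoord (acodim bsize zcount UCMix)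
open Summit.PneNP.PneNP.Theorems.ClusCube (V codimIn L1Cert l1Cert_holds)

variable {M n : ℕ}

/-- The two certificate codimensions agree (same `sInf`). -/
theorem acodim_eq_codimIn (Y : Finset (Fin M → ZMod 2)) (y : Fin M → ZMod 2) : acodim M Y y = codimIn Y y := rfl

/-- The signed coordinate sum of `L1Cert`: `Σ_{y∈Y} (±1) = 2 Z_i(Y) − |Y|`. -/
theorem sum_sign_eq (Y : Finset (Fin M → ZMod 2)) (i : Fin M) :
    ∑ y ∈ Y, (if y i = 0 then (1 : ℤ) else -1) = 2 * ((Y.filter fun y => y i = 0).card : ℤ) - (Y.card : ℤ) := by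
  rw [Finset.sum_ite, Finset.sum_const, Finset.sum_const, nsmul_eq_mul, nsmul_eq_mul,
    ← Finset.card_filter_add_card_filter_not (s := Y) (fun y => y i = 0)]
  push_cast
  ring

/-- **The hypercube certificate in dimension form**: `Σ_{y∈Y} (M − codim_Y y) ≤ 2 Σ_i #{y ∈ Y : y_i = 0}`
(from the tree's `ClusCube.l1Cert_holds`, via `|2Z_i − |Y|| ≥ |Y| − 2Z_i`). -/
theorem dimSum_le_two_mul_sum_zero (Y : Finset (Fin M → ZMod 2)) :
    ∑ y ∈ Y, ((M : ℤ) - (acodim M Y y : ℤ)) ≤ 2 * ∑ i : Fin M, ((Y.filter fun y => y i = 0).card : ℤ) := by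
  have hL := l1Cert_holds M Y
  simp_rw [sum_sign_eq] at hL
  have habs : ∀ i : Fin M, (Y.card : ℤ) - 2 * ((Y.filter fun y => y i = 0).card : ℤ) ≤
      |2 * ((Y.filter fun y => y i = 0).card : ℤ) - (Y.card : ℤ)| := by
    intro i
    have := neg_le_abs (2 * ((Y.filter fun y => y i = 0).card : ℤ) - (Y.card : ℤ))
    linarith
  have h1 : ∑ i : Fin M, ((Y.card : ℤ) - 2 * ((Y.filter fun y => y i = 0).card : ℤ)) ≤
      ∑ y ∈ Y, (codimIn Y y : ℤ) := (Finset.sum_le_sum fun i _ => habs i).trans hL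
  rw [Finset.sum_sub_distrib, Finset.sum_const, Finset.card_univ, Fintype.card_fin, nsmul_eq_mul,
    ← Finset.mul_sum] at h1
  simp_rw [acodim_eq_codimIn]
  rw [Finset.sum_sub_distrib, Finset.sum_const, nsmul_eq_mul]
  linarith

/-- Per block of size `≤ 1`: `2^{bsize j} Z_j(Y) + (bsize j − 1)|Y| = Σ_{i ∈ block j} 2 Z_i(Y)`. -/
theorem block_term_eq (blk : Fin M → Fin n) (Y : Finset (Fin M → ZMod 2)) (j : Fin n) (hj : bsize blk j ≤ 1) :
    (2 : ℤ) ^ (bsize blk j) * (zcount blk j Y : ℤ) + ((bsize blk j : ℤ) - 1) * (Y.card : ℤ) =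
      ∑ i ∈ univ.filter (fun i => blk i = j), 2 * ((Y.filter fun y => y i = 0).card : ℤ) := by
  rcases Nat.le_one_iff_eq_zero_or_eq_one.mp hj with h0 | h1
  · -- empty block: `Z_j(Y) = |Y|`, the sum is empty
    have hempty : (univ.filter fun i => blk i = j) = ∅ := by
      unfold bsize at h0; exact Finset.card_eq_zero.mp h0
    have hz : zcount blk j Y = Y.card := by
      unfold zcount
      congr 1
      apply Finset.filter_true_of_mem
      intro y _ i hi
      have : i ∈ (univ.filter fun i => blk i = j) := by simp [hi]
      rw [hempty] at this
      exact absurd this (Finset.notMem_empty i)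
    rw [h0, hz, hempty, Finset.sum_empty]
    push_cast
    ring
  · -- singleton block `{i₀}`: `Z_j(Y) = #{y : y i₀ = 0}`
    unfold bsize at h1
    obtain ⟨i₀, hi₀⟩ := Finset.card_eq_one.mp h1
    have hmem : ∀ i, blk i = j ↔ i = i₀ := by
      intro i
      have : i ∈ (univ.filter fun i => blk i = j) ↔ i ∈ ({i₀} : Finset (Fin M)) := by rw [hi₀]
      simpa using this
    have hz : zcount blk j Y = (Y.filter fun y => y i₀ = 0).card := by
      unfold zcount
      congr 1
      apply Finset.filter_congr
      intro y _
      constructor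
      · intro h; exact h i₀ ((hmem i₀).2 rfl)
      · intro h i hi; rw [(hmem i).1 hi]; exact h
    have hb : bsize blk j = 1 := by unfold bsize; exact h1
    rw [hb, hz, hi₀, Finset.sum_singleton]
    push_cast
    ring

end Summit.PneNP.PneNP.Theorems.ClusCoordBaseOnes

namespace Summit.PneNP.PneNP.Theorems.ClusCoord

open Finset
open Summit.PneNP.PneNP.Theorems.ClusCoordBaseOnes

/-- **Registered stub `stub_baseOnes` of path `coord`** (stmt-PneNP-19683, skeleton v10): when every block has size `≤ 1` the mixed
certificate holds — it is the hypercube certificate `m = 1`, PROVED in the tree (`ClusCube.l1Cert_holds`): empty blocks contribute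
`2^0·|Y| − |Y| = 0`, singleton blocks `{i}` contribute `2 Z_i(Y)`, and `Σ_y (M − codim_Y y) ≤ 2 Σ_i Z_i(Y)`. -/
theorem stub_baseOnes : ∀ M n : ℕ, ∀ blk : Fin M → Fin n, ∀ Y : Finset (Fin M → ZMod 2),
    (∀ j : Fin n, bsize blk j ≤ 1) → UCMix M n blk Y := by
  intro M n blk Y hb
  unfold UCMix
  rw [Finset.sum_sub_distrib, Finset.sum_const, nsmul_eq_mul]
  -- the block terms, summed over the blocks, give `2 Σ_i Z_i(Y)`
  have hblocks : ∑ j : Fin n, (2 : ℤ) ^ (bsize blk j) * (zcount blk j Y : ℤ) +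
      (∑ j : Fin n, ((bsize blk j : ℤ) - 1)) * (Y.card : ℤ) =
      2 * ∑ i : Fin M, ((Y.filter fun y => y i = 0).card : ℤ) := by
    rw [Finset.sum_mul, ← Finset.sum_add_distrib]
    rw [Finset.sum_congr rfl fun j _ => block_term_eq blk Y j (hb j)]
    rw [Finset.sum_fiberwise_of_maps_to (s := univ) (t := univ) (g := blk) (fun i _ => Finset.mem_univ _)]
    rw [Finset.mul_sum]
  have hcube := dimSum_le_two_mul_sum_zero (M := M) Y
  linarith

end Summit.PneNP.PneNP.Theorems.ClusCoord
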